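import Literature.Computability.QuantumComplexity.OneQubitEuler
import Literature.Computability.QuantumComplexity.HTCnotUniversality
import Literature.Computability.Cryptography.QubitRegisterPauliXProofs
import Literature.Computability.Cryptography.QubitRegisterCnotProofs
import HarnessLib

/-!
# Controlled one-qubit gates from one-qubit gates and `CNOT` (Barenco et al. 1995, §§5–7)

Topic `Literature/Computability/QuantumComplexity`, grouping namespace `Barenco` (the paper
A. Barenco et al., *Elementary gates for quantum computation*, 1995). Gate-synthesis layer of the
discharge of `barenco1995_exactUniversality` (`HTCnotUniversality.lean`: one-qubit gates and `CNOT`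
generate `U(2^n)` exactly); the linear-algebra layer (two-level unitaries generate `U(ι)`) is
`TwoLevelUnitary.lean`. Main result: **every multi-controlled one-qubit gate `∧_C(W)`**
(`W ∈ U(2)`, any finite set `C` of control wires, any target wire `t ∉ C`) **lies in the subgroup
of `U(2^n)` generated by the placements of one-qubit gates and of `CNOT`** (`inGen_mc`; Barenco
et al. 1995, Lemma 7.5 / Cor. 7.6 with Lemmas 5.1, 5.2, 6.1; Nielsen–Chuang 2010, §4.3).

A *controlled gate with target wire `t`* is a matrix on `QReg n` that does not change the bits off
`t` and acts on bit `t` by a `2 × 2` block depending on the other bits (Barenco et al. write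
`∧_m(U)` for the block `U` controlled by `m` wires, §2):

* `ctrl t B` — the matrix with blocks `B z` (`z` the label with bit `t` cleared, `clr t`); the
  **block calculus** `ctrl_mul` (blocks multiply pointwise), `ctrl_one`, `ctrl_conjTranspose`,
  `ctrl_mem_unitaryGroup`, `ctrl_diagonal`, `ctrl_ite_pauliX` (blocks in `{X, 1}` give the
  permutation matrix of a controlled bit flip `flipPerm`);
* `mc C t W = ∧_C(W)` — `W` on wire `t` controlled by the wires of `C` (all required to be `1`);
  `mc_mul`, `mc_conj` (conjugating by a gate on the target conjugates the block — the mechanism of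
  Lemma 5.1), `mc_smul_one` (a controlled global phase is a phase gate on one control fewer,
  Lemma 5.2), the diagonal and permutation forms `mc_diag`, `mc_pauliX`, and the generators
  `mc_empty` (`∧_∅(W)` = `W` placed on wire `t`), `mc_singleton_pauliX` (`∧_{c}(X) = CNOT`);
* the two **networks**, specialised to diagonal blocks so that each identity is between products
  of diagonal and permutation matrices and is checked on basis labels:
  `mc_singleton_diag_sq` — `∧₁(diag(1, v²))` from two `CNOT`s and three phase gates (Lemma 5.1
  with diagonal `A, B, C`, plus the gate `E` of Lemma 5.2; Nielsen–Chuang Fig. 4.6), and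
  `mc_insert_diag_sq` — **Lemma 7.5** for `U = diag(1, v²)`, `V = diag(1, v)`:
  `∧_{C ∪ {a}}(U)_t = ∧_{a}(V)_t · ∧_C(X)_a · ∧_{a}(V†)_t · ∧_C(X)_a · ∧_C(V)_t`;
* general blocks are reduced to diagonal ones by the `Z`–`X`–`Z` Euler decomposition
  (`OneQubit.exists_euler`) and Hadamard conjugation on the target (`inGen_mc_of_diag`); then
  `InGen n M` ("`M` is unitary and generated"), `inGen_mc_zero`, `inGen_mc_one` (Cor. 5.3),
  **`inGen_mc`** (induction on `|C|`, Cor. 7.6; no ancilla wires).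

## References

* A. Barenco, C. H. Bennett, R. Cleve, D. P. DiVincenzo, N. Margolus, P. Shor, T. Sleator,
  J. A. Smolin, H. Weinfurter, *Elementary gates for quantum computation*, Phys. Rev. A 52 (1995)
  3457–3467, arXiv:quant-ph/9503016, §2 (notation `∧_m(U)`), Lemmas 5.1, 5.2, Cor. 5.3,
  Lemma 6.1, Lemma 7.5, Cor. 7.6 [BarencoEtAl1995].
* M. A. Nielsen, I. L. Chuang, *Quantum Computation and Quantum Information*, CUP 2010, §4.3
  (controlled operations, Figs. 4.6–4.10) [NielsenChuang2010].

## Design notes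

* The blocks of `ctrl t B` are read at the label with bit `t` cleared, so no side condition "the
  block does not depend on bit `t`" is needed (compare `ctrlGate` of `SandwichApprox.lean`, which
  imports the operator-norm development and is therefore not reused here).
* Blocks are `Matrix (QReg 1) (QReg 1) ℂ`, so that the one-qubit calculus `OneQubit.m2`, `rz` and
  `OneQubit.exists_euler` apply verbatim; square roots `V` of the blocks are only ever needed for
  diagonal blocks, where they are `diag(1, v)`.
* What is NOT here: the reduction of two-level unitaries on `QReg n` to `∧_C(W)` (wire
  permutations by `CNOT`/`X` conjugation) and the final assembly of
  `barenco1995_exactUniversality`; gate counts (the `Θ(n²)` of Cor. 7.6) are not tracked.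
-/

noncomputable section

namespace Literature.Computability.QuantumComplexity.Barenco

open Cryptography Matrix OneQubit

variable {n : ℕ}


/-! ### Labels: agreement off a wire, clearing a bit -/

/-- The label `x` with bit `t` cleared. [folklore] -/
def clr (t : Fin n) (x : QReg n) : QReg n := Function.update x t false

/-- `clr` ignores the bit it clears. [folklore] -/
@[simp] theorem clr_update (t : Fin n) (x : QReg n) (b : Bool) :
    clr t (Function.update x t b) = clr t x := by
  simp [clr]

/-- Bits of `clr t x` off `t`. [folklore] -/
theorem clr_apply_of_ne {t i : Fin n} (h : i ≠ t) (x : QReg n) : clr t x i = x i := by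
  simp [clr, Function.update_of_ne h]

/-- Bit `t` of `clr t x`. [folklore] -/
@[simp] theorem clr_apply_self (t : Fin n) (x : QReg n) : clr t x t = false := by
  simp [clr]

/-- Two labels agreeing off `t` have the same cleared label. [folklore] -/
theorem clr_eq_of_agree {t : Fin n} {x y : QReg n} (h : ∀ i, i ≠ t → x i = y i) :
    clr t y = clr t x := by
  funext i
  by_cases hi : i = t
  · subst hi; simp
  · rw [clr_apply_of_ne hi, clr_apply_of_ne hi, h i hi]

/-- A label agreeing with `x` off `t` is `x` with bit `t` reset. [folklore] -/
theorem eq_update_of_agree {t : Fin n} {x y : QReg n} (h : ∀ i, i ≠ t → x i = y i) :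
    y = Function.update x t (y t) :=
  Function.eq_update_iff.2 ⟨rfl, fun i hi => (h i hi).symm⟩

/-- `x` agrees with `update x t b` off `t`. [folklore] -/
theorem agree_update (t : Fin n) (x : QReg n) (b : Bool) :
    ∀ i, i ≠ t → x i = Function.update x t b i :=
  fun _ hi => (Function.update_of_ne hi b x).symm

/-- `clr t x = x[t ↦ false]` agrees with `x` off `t` (definitional restatement). [folklore] -/
theorem clr_eq_update (t : Fin n) (x : QReg n) : clr t x = Function.update x t false := rfl

/-! ### Controlled gates with label-dependent blocks -/

/-- **Controlled gate with target wire `t` and blocks `B`**: the matrix that leaves the bits off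
`t` unchanged and acts on bit `t` by the `2 × 2` block `B z`, where `z = clr t y` is the label of
the other wires (Barenco et al. 1995, §2; Nielsen–Chuang 2010, §4.3). [cite: BarencoEtAl1995, §2] -/
def ctrl (t : Fin n) (B : QReg n → Matrix (QReg 1) (QReg 1) ℂ) : Matrix (QReg n) (QReg n) ℂ :=
  Matrix.of fun x y =>
    if ∀ i, i ≠ t → x i = y i then B (clr t y) (fun _ => x t) (fun _ => y t) else 0

/-- Entries of `ctrl`. [folklore] -/
theorem ctrl_apply (t : Fin n) (B : QReg n → Matrix (QReg 1) (QReg 1) ℂ) (x y : QReg n) :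
    ctrl t B x y =
      if ∀ i, i ≠ t → x i = y i then B (clr t y) (fun _ => x t) (fun _ => y t) else 0 := rfl

/-- The entry of `ctrl t B` between two resettings of the same label. [folklore] -/
theorem ctrl_apply_update (t : Fin n) (B : QReg n → Matrix (QReg 1) (QReg 1) ℂ) (x : QReg n)
    (b b' : Bool) :
    ctrl t B (Function.update x t b) (Function.update x t b') = B (clr t x) (fun _ => b) (fun _ => b') := by
  rw [ctrl_apply, if_pos]
  · simp
  · intro i hi
    rw [Function.update_of_ne hi, Function.update_of_ne hi]

/-- **Block calculus: products.** Controlled gates with the same target multiply blockwise.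
(Barenco et al. 1995, §5, the computations behind Lemmas 5.1–5.3.) [cite: BarencoEtAl1995, §5] -/
theorem ctrl_mul (t : Fin n) (B B' : QReg n → Matrix (QReg 1) (QReg 1) ℂ) :
    ctrl t B * ctrl t B' = ctrl t (fun z => B z * B' z) := by
  ext x y
  rw [Matrix.mul_apply, ctrl_apply]
  by_cases hxy : ∀ i, i ≠ t → x i = y i
  · rw [if_pos hxy]
    have hne : Function.update x t false ≠ Function.update x t true := fun h => by
      have := congrFun h t; simp at this
    rw [Fintype.sum_eq_add (Function.update x t false) (Function.update x t true) hne]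
    · have hcy : clr t y = clr t x := clr_eq_of_agree hxy
      have h1 : ∀ b : Bool, ∀ i, i ≠ t → Function.update x t b i = y i := fun b i hi => by
        rw [Function.update_of_ne hi]; exact hxy i hi
      simp only [ctrl_apply, if_pos (agree_update t x _), if_pos (h1 _), clr_update, hcy,
        Function.update_self, Matrix.mul_apply, sum_qReg_one]
    · rintro w ⟨hw0, hw1⟩
      rw [ctrl_apply]
      by_cases hxw : ∀ i, i ≠ t → x i = w i
      · exfalso
        have hw := eq_update_of_agree hxw
        cases hwt : w t
        · exact hw0 (by rw [hw, hwt])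
        · exact hw1 (by rw [hw, hwt])
      · rw [if_neg hxw, zero_mul]
  · rw [if_neg hxy]
    refine Finset.sum_eq_zero fun w _ => ?_
    rw [ctrl_apply, ctrl_apply]
    by_cases hxw : ∀ i, i ≠ t → x i = w i
    · have hwy : ¬ ∀ i, i ≠ t → w i = y i := fun hwy => hxy fun i hi => (hxw i hi).trans (hwy i hi)
      rw [if_neg hwy, mul_zero]
    · rw [if_neg hxw, zero_mul]

/-- **Block calculus: the identity.** [folklore] -/
theorem ctrl_one (t : Fin n) : ctrl t (fun _ => (1 : Matrix (QReg 1) (QReg 1) ℂ)) = 1 := by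
  ext x y
  rw [ctrl_apply, Matrix.one_apply, Matrix.one_apply]
  by_cases hxy : ∀ i, i ≠ t → x i = y i
  · rw [if_pos hxy]
    by_cases h : x = y
    · subst h; simp
    · have hne : x t ≠ y t := fun ht => h (by
        rw [eq_update_of_agree hxy, ← ht]; simp)
      rw [if_neg h, if_neg]
      exact fun hf => hne (congrFun hf 0)
  · rw [if_neg hxy, if_neg]
    rintro rfl
    exact hxy fun i _ => rfl

/-- **Block calculus: adjoints.** [folklore] -/
theorem ctrl_conjTranspose (t : Fin n) (B : QReg n → Matrix (QReg 1) (QReg 1) ℂ) :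
    (ctrl t B)ᴴ = ctrl t (fun z => (B z)ᴴ) := by
  ext x y
  rw [Matrix.conjTranspose_apply, ctrl_apply, ctrl_apply]
  by_cases hxy : ∀ i, i ≠ t → x i = y i
  · have hyx : ∀ i, i ≠ t → y i = x i := fun i hi => (hxy i hi).symm
    rw [if_pos hyx, if_pos hxy, Matrix.conjTranspose_apply, clr_eq_of_agree hxy]
  · have hyx : ¬ ∀ i, i ≠ t → y i = x i := fun hyx => hxy fun i hi => (hyx i hi).symm
    rw [if_neg hyx, if_neg hxy, star_zero]

/-- **Controlled gates with unitary blocks are unitary.** [cite: BarencoEtAl1995, §2] -/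
theorem ctrl_mem_unitaryGroup (t : Fin n) {B : QReg n → Matrix (QReg 1) (QReg 1) ℂ}
    (hB : ∀ z, B z ∈ Matrix.unitaryGroup (QReg 1) ℂ) : ctrl t B ∈ Matrix.unitaryGroup (QReg n) ℂ := by
  rw [Matrix.mem_unitaryGroup_iff, star_eq_conjTranspose, ctrl_conjTranspose, ctrl_mul]
  have : (fun z => B z * (B z)ᴴ) = fun _ => (1 : Matrix (QReg 1) (QReg 1) ℂ) := by
    funext z
    have h := Matrix.mem_unitaryGroup_iff.1 (hB z)
    rwa [star_eq_conjTranspose] at h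
  rw [this, ctrl_one]

/-- **Diagonal blocks give a diagonal matrix.** [folklore] -/
theorem ctrl_diagonal (t : Fin n) (d : QReg n → QReg 1 → ℂ) :
    ctrl t (fun z => Matrix.diagonal (d z)) = Matrix.diagonal fun x => d (clr t x) (fun _ => x t) := by
  ext x y
  rw [ctrl_apply, Matrix.diagonal_apply, Matrix.diagonal_apply]
  by_cases hxy : ∀ i, i ≠ t → x i = y i
  · rw [if_pos hxy, clr_eq_of_agree hxy]
    by_cases h : x = y
    · subst h; simp
    · have hne : x t ≠ y t := fun ht => h (by
        rw [eq_update_of_agree hxy, ← ht]; simp)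
      rw [if_neg h, if_neg]
      exact fun hf => hne (congrFun hf 0)
  · rw [if_neg hxy, if_neg]
    rintro rfl
    exact hxy fun i _ => rfl

/-! ### Permutation matrices -/

/-- Entries of a permutation matrix: `P_σ x y = [σ x = y]`. [folklore] -/
theorem permMatrix_apply (σ : Equiv.Perm (QReg n)) (x y : QReg n) :
    σ.permMatrix ℂ x y = if σ x = y then 1 else 0 := by
  simp [Equiv.Perm.permMatrix, PEquiv.toMatrix_apply, Equiv.toPEquiv_apply, eq_comm]

/-- A permutation matrix is unitary. [folklore] -/
theorem permMatrix_mem_unitaryGroup (σ : Equiv.Perm (QReg n)) :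
    σ.permMatrix ℂ ∈ Matrix.unitaryGroup (QReg n) ℂ := by
  rw [Matrix.mem_unitaryGroup_iff, star_eq_conjTranspose, Matrix.conjTranspose_permMatrix,
    ← Matrix.permMatrix_mul, inv_mul_cancel, Matrix.permMatrix_one]

/-- **Conjugating by a permutation matrix reindexes**: `P_σ M P_{σ⁻¹} = M ∘ (σ × σ)`. [folklore] -/
theorem permMatrix_mul_mul_permMatrix_inv (σ : Equiv.Perm (QReg n)) (M : Matrix (QReg n) (QReg n) ℂ) :
    σ.permMatrix ℂ * M * σ⁻¹.permMatrix ℂ = M.submatrix σ σ := by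
  rw [Equiv.Perm.permMatrix, Equiv.Perm.permMatrix, PEquiv.toMatrix_toPEquiv_mul,
    PEquiv.mul_toMatrix_toPEquiv]
  rfl

/-- **Conjugating a diagonal matrix by a permutation matrix permutes the diagonal.** [folklore] -/
theorem permMatrix_mul_diagonal_mul_permMatrix_inv (σ : Equiv.Perm (QReg n)) (d : QReg n → ℂ) :
    σ.permMatrix ℂ * Matrix.diagonal d * σ⁻¹.permMatrix ℂ = Matrix.diagonal (d ∘ σ) := by
  rw [permMatrix_mul_mul_permMatrix_inv, Matrix.submatrix_diagonal_equiv]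

/-- The controlled bit flip: flip bit `t` of `x` when the predicate `p` holds at `clr t x`.
It is an involution. [folklore] -/
theorem flipIf_involutive (t : Fin n) (p : QReg n → Prop) [DecidablePred p] :
    Function.Involutive fun x : QReg n => if p (clr t x) then Function.update x t (!x t) else x := by
  intro x
  by_cases hp : p (clr t x)
  · simp only [if_pos hp, clr_update, Function.update_self, Bool.not_not, Function.update_idem,
      Function.update_eq_self]
  · simp only [if_neg hp]

/-- The controlled bit flip as a permutation of the labels. [folklore] -/
def flipPerm (t : Fin n) (p : QReg n → Prop) [DecidablePred p] : Equiv.Perm (QReg n) :=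
  (flipIf_involutive t p).toPerm _

/-- Action of `flipPerm`. [folklore] -/
theorem flipPerm_apply (t : Fin n) (p : QReg n → Prop) [DecidablePred p] (x : QReg n) :
    flipPerm t p x = if p (clr t x) then Function.update x t (!x t) else x := rfl

/-- `flipPerm` is its own inverse. [folklore] -/
theorem flipPerm_inv (t : Fin n) (p : QReg n → Prop) [DecidablePred p] :
    (flipPerm t p)⁻¹ = flipPerm t p := by
  rw [inv_eq_iff_mul_eq_one]
  exact Equiv.ext fun x => (flipIf_involutive t p) x

/-- **Blocks in `{X, 1}` give a permutation matrix**: the controlled gate flipping bit `t` exactly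
when `p` holds is the permutation matrix of `flipPerm t p`. [folklore] -/
theorem ctrl_ite_pauliX (t : Fin n) (p : QReg n → Prop) [DecidablePred p] :
    ctrl t (fun z => if p z then pauliX else 1) = (flipPerm t p).permMatrix ℂ := by
  ext x y
  rw [ctrl_apply, permMatrix_apply, flipPerm_apply]
  by_cases hxy : ∀ i, i ≠ t → x i = y i
  · rw [if_pos hxy, clr_eq_of_agree hxy]
    have hy := eq_update_of_agree hxy
    by_cases hp : p (clr t x)
    · rw [if_pos hp, if_pos hp, pauliX_apply]
      change (if x t = y t then (0 : ℂ) else 1) = _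
      by_cases ht : x t = y t
      · rw [if_pos ht, if_neg]
        intro h
        have := congrFun h t
        rw [Function.update_self, ht] at this
        exact Bool.not_ne_self _ this
      · rw [if_neg ht, if_pos]
        have hb : (!x t) = y t := by
          revert ht
          cases x t <;> cases y t <;> simp
        rw [hb]
        exact hy.symm
    · rw [if_neg hp, if_neg hp, Matrix.one_apply]
      by_cases ht : x t = y t
      · rw [if_pos (funext fun _ => ht), if_pos]
        rw [hy, ← ht]; simp
      · rw [if_neg (fun h => ht (congrFun h 0)), if_neg]
        intro h; exact ht (by rw [h])
  · rw [if_neg hxy]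
    split_ifs with hp h h
    · exfalso; apply hxy; intro i hi; rw [← h, Function.update_of_ne hi]
    · rfl
    · exfalso; exact hxy (h ▸ fun i _ => rfl)
    · rfl

/-! ### Multi-controlled one-qubit gates `∧_C(W)` -/

/-- **`∧_C(W)`, the gate `W` on wire `t` controlled by the wires of `C`** (applied exactly when
all bits in `C` are `1`; Barenco et al. 1995, §2, `∧_m(U)`; Nielsen–Chuang 2010, §4.3,
`C^n(U)`). Intended for `t ∉ C`. [cite: BarencoEtAl1995, §2] -/
def mc (C : Finset (Fin n)) (t : Fin n) (W : Matrix (QReg 1) (QReg 1) ℂ) : Matrix (QReg n) (QReg n) ℂ :=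
  ctrl t fun z => if ∀ c ∈ C, z c = true then W else 1

/-- The control condition does not see bit `t ∉ C`. [folklore] -/
theorem forall_clr_iff {C : Finset (Fin n)} {t : Fin n} (ht : t ∉ C) (x : QReg n) :
    (∀ c ∈ C, clr t x c = true) ↔ ∀ c ∈ C, x c = true := by
  refine forall₂_congr fun c hc => ?_
  rw [clr_apply_of_ne (by rintro rfl; exact ht hc)]

/-- `∧_C` is multiplicative in the block. [cite: BarencoEtAl1995, §2] -/
theorem mc_mul (C : Finset (Fin n)) (t : Fin n) (W W' : Matrix (QReg 1) (QReg 1) ℂ) :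
    mc C t (W * W') = mc C t W * mc C t W' := by
  rw [mc, mc, mc, ctrl_mul]
  congr 1
  funext z
  split_ifs <;> simp

/-- `∧_C(1) = 1`. [folklore] -/
theorem mc_one (C : Finset (Fin n)) (t : Fin n) : mc C t (1 : Matrix (QReg 1) (QReg 1) ℂ) = 1 := by
  rw [mc, ← ctrl_one t]
  congr 1
  funext z
  split_ifs <;> rfl

/-- `∧_C(W)` is unitary for unitary `W`. [cite: BarencoEtAl1995, §2] -/
theorem mc_mem_unitaryGroup (C : Finset (Fin n)) (t : Fin n) {W : Matrix (QReg 1) (QReg 1) ℂ}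
    (hW : W ∈ Matrix.unitaryGroup (QReg 1) ℂ) : mc C t W ∈ Matrix.unitaryGroup (QReg n) ℂ :=
  ctrl_mem_unitaryGroup t fun z => by
    by_cases h : ∀ c ∈ C, z c = true
    · simp only [if_pos h]; exact hW
    · simp only [if_neg h]; exact Submonoid.one_mem _

/-- **Conjugation by a gate on the target wire conjugates the block** (the mechanism of Barenco
et al. 1995, Lemma 5.1: outside the controlled subspace `A · 1 · A⁻¹ = 1`).
[cite: BarencoEtAl1995, §5 Lemma 5.1] -/
theorem mc_conj (C : Finset (Fin n)) (t : Fin n) (A W A' : Matrix (QReg 1) (QReg 1) ℂ)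
    (hA : A * A' = 1) : mc ∅ t A * mc C t W * mc ∅ t A' = mc C t (A * W * A') := by
  rw [mc, mc, mc, mc, ctrl_mul, ctrl_mul]
  congr 1
  funext z
  simp only [Finset.notMem_empty, IsEmpty.forall_iff, implies_true, if_true]
  split_ifs
  · rfl
  · rw [Matrix.mul_one, hA]

/-- The diagonal one-qubit matrix `diag(a, d)` in the entrywise form `m2 a 0 0 d`. [folklore] -/
theorem m2_diag_eq_diagonal (a d : ℂ) :
    m2 a 0 0 d = Matrix.diagonal fun u : QReg 1 => if u 0 = true then d else a := by
  ext x y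
  rw [m2_apply, Matrix.diagonal_apply]
  obtain rfl | rfl := eq_q0_or_eq_q1 x <;> obtain rfl | rfl := eq_q0_or_eq_q1 y <;>
    simp [q0_ne_q1, q0_ne_q1.symm]

/-- **Diagonal form**: `∧_C(diag(a, d))` is the diagonal matrix with entry `d` (resp. `a`) at the
labels with all control bits set and target bit `1` (resp. `0`), and `1` elsewhere (`t ∉ C`).
[cite: BarencoEtAl1995, §2] -/
theorem mc_diag {C : Finset (Fin n)} {t : Fin n} (ht : t ∉ C) (a d : ℂ) :
    mc C t (m2 a 0 0 d) =
      Matrix.diagonal fun x => if ∀ c ∈ C, x c = true then (if x t = true then d else a) else 1 := by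
  have hblock : (fun z : QReg n => if ∀ c ∈ C, z c = true then m2 a 0 0 d else 1) =
      fun z => Matrix.diagonal fun u : QReg 1 =>
        if ∀ c ∈ C, z c = true then (if u 0 = true then d else a) else 1 := by
    funext z
    by_cases h : ∀ c ∈ C, z c = true
    · rw [if_pos h, m2_diag_eq_diagonal]; simp only [if_pos h]
    · rw [if_neg h]; simp only [if_neg h, Matrix.diagonal_one]
  rw [mc, hblock, ctrl_diagonal]
  congr 1
  funext x
  exact if_congr (forall_clr_iff ht x) rfl rfl

/-- **A controlled global phase is a phase gate on one control fewer** (Barenco et al. 1995,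
Lemma 5.2 and eq. (10): `∧₁(e^{iδ}) = E ⊗ 1` with `E = diag(1, e^{iδ})` on the control wire):
for `c₀ ∈ C` and `t ∉ C`, `∧_C(c·1)` on target `t` equals `∧_{C∖{c₀}}(diag(1, c))` on target `c₀`.
[cite: BarencoEtAl1995, §5 Lemma 5.2] -/
theorem mc_smul_one {C : Finset (Fin n)} {t c₀ : Fin n} (ht : t ∉ C) (hc₀ : c₀ ∈ C) (c : ℂ) :
    mc C t (c • (1 : Matrix (QReg 1) (QReg 1) ℂ)) = mc (C.erase c₀) c₀ (m2 1 0 0 c) := by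
  have hsm : c • (1 : Matrix (QReg 1) (QReg 1) ℂ) = m2 c 0 0 c := smul_one_eq_m2 c
  rw [hsm, mc_diag ht, mc_diag (Finset.notMem_erase c₀ C)]
  congr 1
  funext x
  by_cases hall : ∀ c ∈ C, x c = true
  · have h1 : ∀ c ∈ C.erase c₀, x c = true := fun c hc => hall c (Finset.mem_of_mem_erase hc)
    rw [if_pos hall, if_pos h1, if_pos (hall c₀ hc₀), ite_self]
  · rw [if_neg hall]
    by_cases h1 : ∀ c ∈ C.erase c₀, x c = true
    · rw [if_pos h1, if_neg]
      intro h0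
      exact hall fun c hc => by
        by_cases hcc : c = c₀
        · rw [hcc]; exact h0
        · exact h1 c (Finset.mem_erase.2 ⟨hcc, hc⟩)
    · rw [if_neg h1]

/-- **Permutation form**: `∧_C(X)` on target `t ∉ C` is the permutation matrix of the controlled
bit flip. [cite: BarencoEtAl1995, §2] -/
theorem mc_pauliX (C : Finset (Fin n)) (t : Fin n) :
    mc C t pauliX = (flipPerm t fun z => ∀ c ∈ C, z c = true).permMatrix ℂ := by
  rw [mc, ctrl_ite_pauliX]

/-! ### The generators: one-qubit placements and `CNOT` placements -/

/-- An embedding `Fin 1 ↪ Fin n` is `wireEmb` of its value. [folklore] -/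
theorem eq_wireEmb (e : Fin 1 ↪ Fin n) : e = wireEmb (e 0) := by
  ext k
  rw [wireEmb_apply, Subsingleton.elim k 0]

/-- **`∧_∅(W)` is the placement of `W` on wire `t`.** [cite: NielsenChuang2010, §4.3] -/
theorem mc_empty (t : Fin n) (W : Matrix (QReg 1) (QReg 1) ℂ) : mc ∅ t W = placeGate (wireEmb t) W := by
  ext x y
  rw [mc, ctrl_apply, placeGate_apply]
  simp only [Finset.notMem_empty, IsEmpty.forall_iff, implies_true, if_true, range_wireEmb,
    Set.mem_singleton_iff]
  rfl

/-- A constant-block controlled gate is `∧_∅`. [folklore] -/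
theorem ctrl_const (t : Fin n) (W : Matrix (QReg 1) (QReg 1) ℂ) : ctrl t (fun _ => W) = mc ∅ t W := by
  rw [mc]
  congr 1
  funext z
  simp

/-- **`∧_{c}(X) = CNOT` with control `c` and target `t`.** [cite: NielsenChuang2010, §4.3] -/
theorem mc_singleton_pauliX {c t : Fin n} (hct : c ≠ t) :
    mc {c} t pauliX = placeGate (pairEmb c t hct) cnot := by
  ext x y
  rw [mc, ctrl_apply, placeGate_apply]
  have hrange : ∀ i, i ∉ Set.range (pairEmb c t hct) ↔ (i ≠ c ∧ i ≠ t) := fun i => by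
    rw [range_pairEmb]; simp [not_or]
  have hcn : cnot (x ∘ pairEmb c t hct) (y ∘ pairEmb c t hct) =
      if x c = y c ∧ x t = (y t ^^ y c) then 1 else 0 := rfl
  by_cases hxy : ∀ i, i ≠ t → x i = y i
  · have hoff : ∀ i, i ∉ Set.range (pairEmb c t hct) → x i = y i :=
      fun i hi => hxy i ((hrange i).1 hi).2
    rw [if_pos hxy, if_pos hoff, hcn, clr_eq_of_agree hxy]
    have hc : x c = y c := hxy c hct
    have hcond : (∀ c' ∈ ({c} : Finset (Fin n)), clr t x c' = true) ↔ x c = true := by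
      simp [clr_apply_of_ne hct]
    by_cases hxc : x c = true
    · rw [if_pos (hcond.2 hxc), pauliX_apply]
      change (if x t = y t then (0 : ℂ) else 1) = _
      rw [← hc, hxc]
      cases x t <;> cases y t <;> simp
    · rw [if_neg (fun h => hxc (hcond.1 h)), Matrix.one_apply]
      have hxc' : x c = false := by simpa using hxc
      rw [← hc, hxc']
      simp only [Bool.xor_false, true_and]
      by_cases ht : x t = y t
      · rw [if_pos (funext fun _ => ht), if_pos ht]
      · rw [if_neg (fun h => ht (congrFun h 0)), if_neg ht]
  · rw [if_neg hxy]
    by_cases hoff : ∀ i, i ∉ Set.range (pairEmb c t hct) → x i = y i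
    · rw [if_pos hoff, hcn, if_neg]
      rintro ⟨hc, -⟩
      exact hxy fun i hi => if hic : i = c then (by rw [hic]; exact hc) else hoff i ((hrange i).2 ⟨hic, hi⟩)
    · rw [if_neg hoff]


/-! ### One-qubit diagonal gates -/

/-- `diag(a, d)` is unitary for unit `a, d`. [folklore] -/
theorem m2_diag_mem_unitaryGroup {a d : ℂ} (ha : ‖a‖ = 1) (hd : ‖d‖ = 1) :
    m2 a 0 0 d ∈ Matrix.unitaryGroup (QReg 1) ℂ := by
  rw [Matrix.mem_unitaryGroup_iff, star_m2, m2_mul_m2, one_eq_m2, m2_inj]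
  simp [mul_conj_eq_one ha, mul_conj_eq_one hd]

/-- `rz u = u • diag(1, ū²)` for a unit `u`. [folklore] -/
theorem rz_eq_smul_diag {u : ℂ} (hu : ‖u‖ = 1) :
    rz u = u • m2 1 0 0 (starRingEnd ℂ u * starRingEnd ℂ u) := by
  rw [rz, smul_m2, m2_inj]
  refine ⟨by ring, by ring, by ring, ?_⟩
  rw [← mul_assoc, mul_conj_eq_one hu, one_mul]

/-! ### Conjugating diagonal matrices by the controlled bit flip -/

/-- The controlled bit flip is an involution on matrices: `P D P = diag(d ∘ σ)` for diagonal `D`.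
[folklore] -/
theorem flipPerm_conj_diagonal (t : Fin n) (p : QReg n → Prop) [DecidablePred p] (d : QReg n → ℂ) :
    (flipPerm t p).permMatrix ℂ * Matrix.diagonal d * (flipPerm t p).permMatrix ℂ =
      Matrix.diagonal (d ∘ flipPerm t p) := by
  have h := permMatrix_mul_diagonal_mul_permMatrix_inv (flipPerm t p) d
  rwa [flipPerm_inv] at h

/-! ### The two diagonal networks -/

/-- **The controlled phase from two `CNOT`s** (Barenco et al. 1995, Lemma 5.1 with diagonal
`A = B⁻¹ = diag(1, v)`-type factors and the phase gate of Lemma 5.2; Nielsen–Chuang 2010, §4.3,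
Fig. 4.6 / Ex. 4.21): for `a ≠ t` and a unit `v`,
`∧_{a}(diag(1, v²))_t = D_a(v) · D_t(v) · CNOT_{a,t} · D_t(v̄) · CNOT_{a,t}` with `D(v) = diag(1, v)`.
[cite: BarencoEtAl1995, §5 Lemmas 5.1-5.2] -/
theorem mc_singleton_diag_sq {a t : Fin n} (hat : a ≠ t) {v : ℂ} (hv : ‖v‖ = 1) :
    mc {a} t (m2 1 0 0 (v * v)) =
      mc ∅ a (m2 1 0 0 v) * mc ∅ t (m2 1 0 0 v) *
        (mc {a} t pauliX * mc ∅ t (m2 1 0 0 (starRingEnd ℂ v)) * mc {a} t pauliX) := by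
  have hta : t ∉ ({a} : Finset (Fin n)) := by simpa using hat.symm
  rw [mc_diag hta, mc_diag (Finset.notMem_empty a), mc_diag (Finset.notMem_empty t),
    mc_diag (Finset.notMem_empty t), mc_pauliX, flipPerm_conj_diagonal, Matrix.diagonal_mul_diagonal,
    Matrix.diagonal_mul_diagonal]
  congr 1
  funext x
  have hvv : v * starRingEnd ℂ v = 1 := mul_conj_eq_one hv
  simp only [Function.comp_apply, flipPerm_apply, Finset.notMem_empty, IsEmpty.forall_iff,
    implies_true, if_true, Finset.mem_singleton, forall_eq, clr_apply_of_ne hat, ite_apply,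
    Function.update_self]
  cases x a <;> cases x t <;> simp [hvv]

/-- **Barenco et al. 1995, Lemma 7.5 (diagonal block).** For `a ∉ C`, `t ∉ C`, `a ≠ t` and a
unit `v`, with `V = diag(1, v)` (so `V² = diag(1, v²) = U`):
`∧_{C ∪ {a}}(U)_t = ∧_{a}(V)_t · ∧_C(X)_a · ∧_{a}(V†)_t · ∧_C(X)_a · ∧_C(V)_t`
(the printed network, read as operators). [cite: BarencoEtAl1995, §7 Lemma 7.5] -/
theorem mc_insert_diag_sq {C : Finset (Fin n)} {a t : Fin n} (haC : a ∉ C) (htC : t ∉ C)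
    (hat : a ≠ t) {v : ℂ} (hv : ‖v‖ = 1) :
    mc (insert a C) t (m2 1 0 0 (v * v)) =
      mc {a} t (m2 1 0 0 v) *
        (mc C a pauliX * mc {a} t (m2 1 0 0 (starRingEnd ℂ v)) * mc C a pauliX) *
          mc C t (m2 1 0 0 v) := by
  have hta : t ∉ ({a} : Finset (Fin n)) := by simpa using hat.symm
  have htaC : t ∉ insert a C := by simp [hat.symm, htC]
  rw [mc_diag htaC, mc_diag hta, mc_diag hta, mc_diag htC, mc_pauliX, flipPerm_conj_diagonal,
    Matrix.diagonal_mul_diagonal, Matrix.diagonal_mul_diagonal]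
  congr 1
  funext x
  have hvv : v * starRingEnd ℂ v = 1 := mul_conj_eq_one hv
  simp only [Function.comp_apply, flipPerm_apply, Finset.forall_mem_insert, Finset.mem_singleton,
    forall_eq, forall_clr_iff haC, ite_apply, Function.update_self, Function.update_of_ne hat.symm]
  have hvv' : starRingEnd ℂ v * v = 1 := conj_mul_eq_one hv
  by_cases hC : ∀ c ∈ C, x c = true
  · simp only [iff_true_intro hC, and_true, if_true]
    cases x a <;> cases x t <;> simp [hvv']
  · simp only [hC, and_false, if_false]
    cases x a <;> cases x t <;> simp [hvv]

/-! ### Membership in the generated subgroup -/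

/-- `M` is unitary and, as an element of `U(2^n)`, lies in the subgroup generated by the one-qubit
placements and the `CNOT` placements (`oneQubitCnotGenerators n`). [cite: BarencoEtAl1995, abstract] -/
def InGen (n : ℕ) (M : Matrix (QReg n) (QReg n) ℂ) : Prop :=
  ∃ h : M ∈ Matrix.unitaryGroup (QReg n) ℂ,
    (⟨M, h⟩ : Matrix.unitaryGroup (QReg n) ℂ) ∈ Subgroup.closure (oneQubitCnotGenerators n)

/-- `InGen` is closed under products. [folklore] -/
theorem InGen.mul {M N : Matrix (QReg n) (QReg n) ℂ} (hM : InGen n M) (hN : InGen n N) :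
    InGen n (M * N) := by
  obtain ⟨hMu, hM⟩ := hM
  obtain ⟨hNu, hN⟩ := hN
  exact ⟨Submonoid.mul_mem _ hMu hNu, Subgroup.mul_mem _ hM hN⟩

/-- `InGen` transports along equalities. [folklore] -/
theorem InGen.of_eq {M N : Matrix (QReg n) (QReg n) ℂ} (h : M = N) (hN : InGen n N) : InGen n M := h ▸ hN

/-- `InGen` is closed under adjoints. [folklore] -/
theorem InGen.star {M : Matrix (QReg n) (QReg n) ℂ} (hM : InGen n M) : InGen n (star M) := by
  obtain ⟨hMu, hM⟩ := hM
  exact ⟨Unitary.star_mem hMu, Subgroup.inv_mem _ hM⟩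

/-- The identity is generated. [folklore] -/
theorem inGen_one : InGen n (1 : Matrix (QReg n) (QReg n) ℂ) :=
  ⟨Submonoid.one_mem _, Subgroup.one_mem _⟩

/-- A unitary element whose matrix is generated lies in the generated subgroup. [folklore] -/
theorem InGen.mem {U : Matrix.unitaryGroup (QReg n) ℂ} (hU : InGen n (U : Matrix (QReg n) (QReg n) ℂ)) :
    U ∈ Subgroup.closure (oneQubitCnotGenerators n) := by
  obtain ⟨_, h⟩ := hU
  exact h

/-- One-qubit placements are generators. [cite: BarencoEtAl1995, abstract] -/
theorem inGen_placeGate_one (e : Fin 1 ↪ Fin n) {V : Matrix (QReg 1) (QReg 1) ℂ}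
    (hV : V ∈ Matrix.unitaryGroup (QReg 1) ℂ) : InGen n (placeGate e V) :=
  ⟨placeGate_mem_unitaryGroup_holds e hV, Subgroup.subset_closure (Or.inl ⟨e, ⟨V, hV⟩, rfl⟩)⟩

/-- `CNOT` placements are generators. [cite: BarencoEtAl1995, abstract] -/
theorem inGen_placeGate_cnot (e : Fin 2 ↪ Fin n) : InGen n (placeGate e cnot) :=
  ⟨placeGate_mem_unitaryGroup_holds e cnot_mem_unitaryGroup_holds,
    Subgroup.subset_closure (Or.inr ⟨e, rfl⟩)⟩

/-- `∧_∅(W)` (a one-qubit gate on wire `t`) is generated. [cite: BarencoEtAl1995, abstract] -/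
theorem inGen_mc_zero (t : Fin n) {W : Matrix (QReg 1) (QReg 1) ℂ}
    (hW : W ∈ Matrix.unitaryGroup (QReg 1) ℂ) : InGen n (mc ∅ t W) :=
  InGen.of_eq (mc_empty t W) (inGen_placeGate_one _ hW)

/-- `∧_{c}(X) = CNOT` is generated. [cite: BarencoEtAl1995, abstract] -/
theorem inGen_mc_singleton_pauliX {c t : Fin n} (hct : c ≠ t) : InGen n (mc {c} t pauliX) :=
  InGen.of_eq (mc_singleton_pauliX hct) (inGen_placeGate_cnot _)

/-- **Reduction to diagonal blocks** (Euler decomposition on the target wire): if all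
`∧_C(diag(1, v²))` and all controlled global phases `∧_C(c·1)` are generated, then so is every
`∧_C(W)`, `W ∈ U(2)` — write `W = c · R_z · (H R_z H) · R_z` (`OneQubit.exists_euler`),
`R_z = rz u = u · diag(1, ū²)`, and conjugate the middle factor by Hadamard gates on the target
(`mc_conj`). (Barenco et al. 1995, Lemmas 4.1, 5.1; Nielsen–Chuang 2010, Cor. 4.2.)
[cite: BarencoEtAl1995, §5 Lemma 5.1] -/
theorem inGen_mc_of_diag (C : Finset (Fin n)) (t : Fin n)
    (hdiag : ∀ v : ℂ, ‖v‖ = 1 → InGen n (mc C t (m2 1 0 0 (v * v))))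
    (hscal : ∀ c : ℂ, ‖c‖ = 1 → InGen n (mc C t (c • (1 : Matrix (QReg 1) (QReg 1) ℂ)))) :
    ∀ W ∈ Matrix.unitaryGroup (QReg 1) ℂ, InGen n (mc C t W) := by
  -- `∧_C(rz u)` is generated
  have hrz : ∀ u : ℂ, ‖u‖ = 1 → InGen n (mc C t (rz u)) := by
    intro u hu
    have hu' : ‖starRingEnd ℂ u‖ = 1 := by rwa [Complex.norm_conj]
    rw [rz_eq_smul_diag hu, ← smul_one_mul, mc_mul]
    exact (hscal u hu).mul (hdiag _ hu')
  have hH : InGen n (mc ∅ t hGate) := inGen_mc_zero t hGate_mem_unitaryGroup_holds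
  intro W hW
  obtain ⟨c, u₁, u₂, u₃, hc, hu₁, hu₂, hu₃, rfl⟩ := exists_euler hW
  rw [← smul_one_mul, mc_mul, mc_mul, mc_mul, ← mc_conj C t hGate (rz u₂) hGate hGate_mul_hGate]
  exact (hscal c hc).mul (((hrz u₁ hu₁).mul ((hH.mul (hrz u₂ hu₂)).mul hH)).mul (hrz u₃ hu₃))

/-- **Singly-controlled one-qubit gates are generated** (Barenco et al. 1995, Lemma 5.1 and
Cor. 5.3: `∧₁(W)` from `CNOT`s and one-qubit gates; Nielsen–Chuang 2010, Cor. 4.2 / Fig. 4.6).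
[cite: BarencoEtAl1995, §5 Cor. 5.3] -/
theorem inGen_mc_one {a t : Fin n} (hat : a ≠ t) :
    ∀ W ∈ Matrix.unitaryGroup (QReg 1) ℂ, InGen n (mc {a} t W) := by
  apply inGen_mc_of_diag
  · intro v hv
    have hv' : ‖starRingEnd ℂ v‖ = 1 := by rwa [Complex.norm_conj]
    rw [mc_singleton_diag_sq hat hv]
    exact ((inGen_mc_zero a (m2_diag_mem_unitaryGroup norm_one hv)).mul
      (inGen_mc_zero t (m2_diag_mem_unitaryGroup norm_one hv))).mul
      (((inGen_mc_singleton_pauliX hat).mul (inGen_mc_zero t (m2_diag_mem_unitaryGroup norm_one hv'))).mul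
        (inGen_mc_singleton_pauliX hat))
  · intro c hc
    rw [mc_smul_one (by simpa using hat.symm) (Finset.mem_singleton_self a), Finset.erase_singleton]
    exact inGen_mc_zero a (m2_diag_mem_unitaryGroup norm_one hc)

/-- **Multi-controlled one-qubit gates are generated by one-qubit gates and `CNOT`** (Barenco et
al. 1995, Lemma 7.5 and Cor. 7.6, with Lemmas 5.1, 5.2, 6.1; Nielsen–Chuang 2010, §4.3,
Figs. 4.6–4.10): for every finite set `C` of control wires, every target `t ∉ C` and every
`W ∈ U(2)`, `∧_C(W) ∈ ⟨one-qubit placements, CNOT placements⟩`. Induction on `|C|`; no ancilla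
wires are used. [cite: BarencoEtAl1995, §7 Lemma 7.5 and Cor. 7.6] -/
theorem inGen_mc : ∀ (m : ℕ) (C : Finset (Fin n)) (t : Fin n), C.card = m → t ∉ C →
    ∀ W ∈ Matrix.unitaryGroup (QReg 1) ℂ, InGen n (mc C t W) := by
  intro m
  induction m with
  | zero =>
    intro C t hC htC W hW
    rw [Finset.card_eq_zero.1 hC]
    exact inGen_mc_zero t hW
  | succ m ih =>
    intro C t hC htC
    obtain ⟨a, haC⟩ : C.Nonempty := Finset.card_pos.1 (by omega)
    have hat : a ≠ t := fun h => htC (h ▸ haC)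
    have hC' : (C.erase a).card = m := by rw [Finset.card_erase_of_mem haC, hC]; rfl
    have haC' : a ∉ C.erase a := Finset.notMem_erase a C
    have htC' : t ∉ C.erase a := fun h => htC (Finset.mem_of_mem_erase h)
    apply inGen_mc_of_diag
    · -- diagonal blocks: Lemma 7.5 (or Lemma 5.1 when `C = {a}`)
      intro v hv
      rcases Nat.eq_zero_or_pos m with hm | hm
      · -- `C = {a}`
        have hCa : C = {a} := by
          apply Finset.eq_singleton_iff_unique_mem.2 ⟨haC, fun b hb => ?_⟩
          by_contra hba
          have : b ∈ C.erase a := Finset.mem_erase.2 ⟨hba, hb⟩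
          rw [hm, Finset.card_eq_zero] at hC'
          simp [hC'] at this
        rw [hCa]
        exact inGen_mc_one hat _ (m2_diag_mem_unitaryGroup norm_one (by rw [norm_mul, hv, mul_one]))
      · have hv' : ‖starRingEnd ℂ v‖ = 1 := by rwa [Complex.norm_conj]
        rw [← Finset.insert_erase haC, mc_insert_diag_sq haC' htC' hat hv]
        exact ((inGen_mc_one hat _ (m2_diag_mem_unitaryGroup norm_one hv)).mul
          (((ih _ a hC' haC' _ pauliX_mem_unitaryGroup_holds).mul
            (inGen_mc_one hat _ (m2_diag_mem_unitaryGroup norm_one hv'))).mul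
            (ih _ a hC' haC' _ pauliX_mem_unitaryGroup_holds))).mul
          (ih _ t hC' htC' _ (m2_diag_mem_unitaryGroup norm_one hv))
    · -- global phases: a phase gate on the control `a`, with one control fewer
      intro c hc
      rw [mc_smul_one htC haC]
      exact ih _ a hC' haC' _ (m2_diag_mem_unitaryGroup norm_one hc)

end Literature.Computability.QuantumComplexity.Barenco
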